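import Summits.ResolutionOfSingularities.ResolutionOfSingularities.Theses.Descent
import Summits.ResolutionOfSingularities.ResolutionOfSingularities.Theses.WeightedInvariant
import Summits.ResolutionOfSingularities.ResolutionOfSingularities.Theses.UniformComplexity
import HarnessLib

/-!
# Crux `DescentPerfectToAll` (stmt-ResolutionOfSingularities-0549) — line `via-ershov-transfer`

Line card: `Lines/via-ershov-transfer.md`.  Registrar: planner `res-B-lens-4` (2026-08-28, D-0159 rung-B cover,
KEY 4589bc7d8eb6da15, lens «uniformity / ultraproduct conditional bridge»).
**Nothing here proves resolution of singularities in characteristic p.**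

## The line (three stubs, composed BY NAME into `Theses.Descent.DescentPerfectToAll`)

Write `ResOver K` for "every reduced separated finite-type `K`-scheme has a resolution" and
`K_σ := (𝔽_p(t_s : s ∈ σ))^sep = SepRat p σ` for the PRIME MODELS of Ershov's complete theories
`SCF_{p,e}` (separably closed fields of characteristic `p` and imperfection degree `e = #σ ∈ ℕ ∪ {∞}`;
Ershov 1967, Delon 1998 Thm 2.1: `𝔽_p(b₁,…,b_ν)^s` "is uniquely determined and embeds in every model").

* `stub_uniform`  (RESEARCH, load-bearing) `PerfectRes p → UniformSepRes p`:
  resolution over perfect fields ⇒ resolution over every ULTRAPOWER `K_σ^U`.  Over `K_σ` itself (principal `U`)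
  this is LANDED modulo the antecedent (`Theorems.hasResolution_of_perfectRes_of_isSeparable_fg`: `K_σ` is
  separable algebraic over the finitely generated `𝔽_p(t_σ)`, finite `σ`); by Łoś + first-order REGULARITY
  (Zariski–Nagata mixed Jacobian criterion, Matsumura Thm 30.5/30.4(ii), digits w.r.t. a p-independent
  sub-tuple of the coefficients) the non-principal case says exactly: the landed spread-and-resolve
  construction has output complexity bounded in terms of the complexity of `X` ALONE, independently of the
  arithmetic complexity of the coefficients over `𝔽_p(t_σ)` — the uniformity the censuses name as the break
  point of model theory on this crux (STRATEGY-CENSUS §1.4, -b1 "model theory breaks at uniformity").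
* `stub_transfer` (believed TRUE, theorem-grade model theory + commutative algebra, unformalised, XL)
  `UniformSepRes p → SepClosedRes p`: every separably closed `K'` of char `p` is `≡ K_σ` (Ershov completeness),
  hence elementarily embeds in an ultrapower `K_σ^U` (Frayne / Keisler–Shelah); a reduced separated finite-type
  `X'/K'` base-changes to `K_σ^U`, acquires a resolution there, and the resolution DESCENDS because "`X_ā` has a
  resolution of complexity `≤ B`" is a first-order ring formula in the coefficients `ā` (regularity, not
  smoothness: Zariski's criterion + van den Dries–Schmidt faithful flatness / primality bounds + EGA IV §8
  spreading of properness and birationality — the Eklof 1969 / Brünjes–Serpé 2007 Cor. 9.3 transfer with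
  `smooth` replaced by `regular` and `ACF_p` by `SCF_{p,e}`).
* `stub_sepClosureDescent` (RESEARCH) `SepClosureDescent p`: resolvability descends along `k^sep / k`
  (pro-finite Galois descent + EGA IV §8 limits; crux 0550's Galois-equivariance difficulty over an
  IMPERFECT base — only Galois-stable resolutions descend, Kollár 2007 Thm 3.36).

Composition: for a prime `p` and any field `k` of char `p`: `PerfectRes p` (the crux's antecedent) ⇒
`UniformSepRes p` ⇒ `SepClosedRes p` ⇒ `ResOver k^sep` ⇒ `ResOver k`, i.e. `ResolutionInChar p`.

Disproof.lean honoured: §2 `cruxWithoutAntecedent_iff` (dropping `PerfectRes` = the summit) — the antecedent is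
consumed by `stub_uniform` and nowhere else; §6 `crux_of_models` / `HasSeparableFGModel` is the principal-`U`
case of `stub_uniform`; NegativeTarget p1 (`OneRootRobustAtFixedLevel` FALSE) concerns fixed-level robustness
and is not an instance of any stub here (no stub fixes a level of a p-tower).
-/

namespace Summit.ResolutionOfSingularities.ResolutionOfSingularities.Cruxes.DescentPerfectToAll.ViaErshovTransfer

open AlgebraicGeometry CategoryTheory Literature.AlgebraicGeometry.Resolution

/-- Resolution of singularities over the ground field `K`: every reduced, separated `K`-scheme of finite
type has a resolution (`Scheme.HasResolution`: proper birational `X' ⟶ X` with `X'` regular). This is the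
field-wise body of `Literature.AlgebraicGeometry.Resolution.ResolutionInChar`. -/
def ResOver (K : Type) [Field K] : Prop :=
  ∀ (X : Scheme.{0}) (f : X ⟶ Spec (.of K)),
    IsSeparated f → LocallyOfFiniteType f → QuasiCompact f → IsReduced X → Scheme.HasResolution X

/-- The antecedent of the crux: resolution over every perfect field of characteristic `p`. -/
def PerfectRes (p : ℕ) : Prop :=
  ∀ (k : Type) [Field k] [CharP k p] [PerfectField k], ResOver k

/-- The prime model `K_σ = (𝔽_p(t_s : s ∈ σ))^sep` of Ershov's complete theory `SCF_{p,#σ}`: the separable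
closure of the rational function field in the indeterminates `σ` over `𝔽_p`. -/
abbrev SepRat (p : ℕ) [Fact p.Prime] (σ : Type) : Type :=
  SeparableClosure (FractionRing (MvPolynomial σ (ZMod p)))

/-- UNIFORM resolution over the prime models, phrased without a complexity function: resolution over every
ultrapower `K_σ^U` (Łoś: `∀ U, ResOver (K_σ^U)` ⇔ for every complexity bound `c` there is `B(c)` such that every
reduced `X/K_σ` of complexity `≤ c` has a resolution of complexity `≤ B(c)`; principal `U` = plain `ResOver K_σ`,
landed modulo `PerfectRes`). -/
def UniformSepRes (p : ℕ) [Fact p.Prime] : Prop :=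
  ∀ (σ ι : Type) (U : Ultrafilter ι), ResOver ((U : Filter ι).Germ (SepRat p σ))

/-- Resolution over every separably closed field of characteristic `p` (census §3.1's `Sub_S`, unconditional
form). -/
def SepClosedRes (p : ℕ) : Prop :=
  ∀ (K : Type) [Field K] [CharP K p] [IsSepClosed K], ResOver K

/-- Descent of resolvability along the separable closure: for every field `k` of characteristic `p`,
resolution over `k^sep` implies resolution over `k` (pro-finite Galois descent of SOME resolution). -/
def SepClosureDescent (p : ℕ) : Prop :=
  ∀ (k : Type) [Field k] [CharP k p], ResOver (SeparableClosure k) → ResOver k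

/-- STUB (research, load-bearing): resolution over perfect fields ⇒ UNIFORM resolution over the prime models
`K_σ`, i.e. resolution over all their ultrapowers. -/
theorem stub_uniform : ∀ (p : ℕ) [Fact p.Prime], PerfectRes p → UniformSepRes p := by
  sorry

/-- STUB (theorem-grade, unformalised): Ershov completeness of `SCF_{p,e}` + Frayne/Keisler–Shelah + Łoś with
first-order regularity (Zariski–Nagata) ⇒ uniform resolution over the prime models transfers to every separably
closed field of characteristic `p`. -/
theorem stub_transfer : ∀ (p : ℕ) [Fact p.Prime], UniformSepRes p → SepClosedRes p := by
  sorry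

/-- STUB (research): resolvability descends from `k^sep` to `k`. -/
theorem stub_sepClosureDescent : ∀ (p : ℕ) [Fact p.Prime], SepClosureDescent p := by
  sorry

/-- THE SKELETON THEOREM (kernel-checked modulo the three DECLARED STUBS, used by name; no other hypothesis):
the crux `Theses.Descent.DescentPerfectToAll`.  For a prime `p` and a field `k` of char `p`:
`PerfectRes p` ⇒ (`stub_uniform`) `UniformSepRes p` ⇒ (`stub_transfer`) `SepClosedRes p` ⇒ resolution over `k^sep`
⇒ (`stub_sepClosureDescent`) resolution over `k`. -/
theorem DescentPerfectToAll_proof : Theses.Descent.DescentPerfectToAll := by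
  intro p hp hPerf k _ _ X f hs hl hq hr
  haveI : Fact p.Prime := ⟨hp⟩
  have hP : PerfectRes p := fun κ _ _ _ Z g a b c d => hPerf κ Z g a b c d
  have hS : SepClosedRes p := stub_transfer p (stub_uniform p hP)
  haveI : CharP (SeparableClosure k) p :=
    charP_of_injective_algebraMap (algebraMap k (SeparableClosure k)).injective p
  exact stub_sepClosureDescent p k (hS (SeparableClosure k)) X f hs hl hq hr

/-- COMPOSITION with the stub statements as explicit hypotheses (sorry-free; same proof), for provers who close
the stubs under other names.  It concludes the rfl-equal copy `Theses.WeightedInvariant.DescentPerfectToAll` of the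
crux (same item stmt-0549, wanted by the routes Descent / WeightedInvariant / UniformComplexity), so that the register's
skeleton theorem for `Theses.Descent.DescentPerfectToAll` is unambiguously `DescentPerfectToAll_proof` above. -/
theorem WeightedInvariant_DescentPerfectToAll_of
    (h₁ : ∀ (p : ℕ) [Fact p.Prime], PerfectRes p → UniformSepRes p)
    (h₂ : ∀ (p : ℕ) [Fact p.Prime], UniformSepRes p → SepClosedRes p)
    (h₃ : ∀ (p : ℕ) [Fact p.Prime], SepClosureDescent p) :
    Theses.WeightedInvariant.DescentPerfectToAll := by
  intro p hp hPerf k _ _ X f hs hl hq hr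
  haveI : Fact p.Prime := ⟨hp⟩
  have hP : PerfectRes p := fun κ _ _ _ Z g a b c d => hPerf κ Z g a b c d
  have hS : SepClosedRes p := h₂ p (h₁ p hP)
  haveI : CharP (SeparableClosure k) p :=
    charP_of_injective_algebraMap (algebraMap k (SeparableClosure k)).injective p
  exact h₃ p k (hS (SeparableClosure k)) X f hs hl hq hr

/-- … and the `UniformComplexity` copy. -/
theorem UniformComplexity_DescentPerfectToAll_of
    (h₁ : ∀ (p : ℕ) [Fact p.Prime], PerfectRes p → UniformSepRes p)
    (h₂ : ∀ (p : ℕ) [Fact p.Prime], UniformSepRes p → SepClosedRes p)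
    (h₃ : ∀ (p : ℕ) [Fact p.Prime], SepClosureDescent p) :
    Theses.UniformComplexity.DescentPerfectToAll :=
  WeightedInvariant_DescentPerfectToAll_of h₁ h₂ h₃

end Summit.ResolutionOfSingularities.ResolutionOfSingularities.Cruxes.DescentPerfectToAll.ViaErshovTransfer
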